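import Summits.QuantumFields.BalabanUV.T4Continuum.Support.SubstrateChartRealSlicePairSpeciesDecay
import Summits.QuantumFields.BalabanUV.T4Continuum.Support.SubstrateDrivenRecordSU

/-!
# SUBSTRATE — [dict] D-3 ∕ D-8 AT THE REFERENCE POINT OF RECORD: THE `SU(n)` READING `ι := fundamentalRep`, THE TRIVIAL DRIVING FIELD,
# AND THE PAIR-CHART SPECIES PACKAGES INHABITED THERE WITH EVERY SMALL-FIELD LETTER DISCHARGED (`α = τ = 0`, `γ = gammaV … a 0 0`)

Cell `pub-balaban`, SUBSTRATE cell, seat `b2b-balaban-substrate-p2` (gen 5).  Summits-side under the LEAN PLACEMENT RULE.  HONEST FRAMING: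
rung (B)+1 of the FINITE-VOLUME T⁴ programme — NOT infinite volume, NOT a mass gap, NOT Clay; spine PROVED 0∕9; NE5 ∕ NE9 NOT PRINTED ∕ NOT
proved.  [folklore] bookkeeping only: no estimate of Bałaban's is asserted.

WHY.  Every chart-species theorem of LIBRARY theme E (L-E3 … L-E12b: `coercive_vecOp_towerDataOf_of_regular`, `rhoStarOfRecord`,
`hslice_*_sectionOfRecord`, …) DISPLAYS the same reading letters `(ι, hι : ι g ∈ U(o), hdist : ‖ι g − 1‖ = dist1 g)` and the same
regular-background letters `(hU : n_k·dist1(M^{K−k}U(b)) ≤ α, hT : ‖T(Γ) − 1‖ ≤ τ, 0 < gammaV |o| d a′ α τ)`, and no file in the tree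
discharges them at a datum.  This file does it at the REFERENCE POINT OF RECORD — the `SU(n)` object `drivenRecordSU F K m′ gA gB`
(p220384, hypothesis-free) driven by the trivial unit-lattice field, read through the fundamental representation:
* §0 `two_le_fine_lev_unitMod` — the torus-size letter `2 ≤ fine (lev P.L k) (unitMod P) μ` of L-A9∕L-A9b holds for EVERY `Params` and level
  (`unitMod P = 2·L^m`, `1 ≤ lev`), so it can be dropped wherever displayed;
* §1 (any `G`, `ι`, averagings fixing `1`) `towerDataOf_one` (the tower data of the trivial configuration is the trivial transporter tower),
  `regU_one` ∕ `regT_towerDataOf_one` (the two regular-background letters hold with `α = 0`, `τ = 0`), `gammaV_zero_zero`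
  (`gammaV co d a′ 0 0 = gammaA d a′ ∕ 2`), `gammaV_zero_zero_pos`;
* §2 THE `SU(n)` READING: `norm_fundamentalRep_sub_one` — `‖fundamentalRep o g − 1‖ = dist1 g` (definitional for the tree's
  `instGaugeGroupSpecialUnitaryGroup`), i.e. `hdist` DISCHARGED; `hι` is `fundamentalRep_mem_unitaryGroup` BY NAME;
* §3 AT THE RECORD `D := drivenRecordSU F K m′ gA gB`, `U.1 = 1`: `transport_val_eq_one` (the transported background is trivial),
  `sectionOfRecord_eq_one` (the section point is the pair of trivial towers), and the two W-17b packages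
  **`hslice_greenT_pair₂_recordOne`**, **`hslice_covAtTLev_pair₂_recordOne`** = p229325 `hslice_greenT_pair₂_sectionOfRecord` ∕
  `hslice_covAtTLev_pair₂_sectionOfRecord` with `ι := fundamentalRep o` and ALL of `hι hdist hα hτ hUA hTA hUB hTB hγVA hγVB` DISCHARGED
  (`α_i = τ_i = 0`, `γ_i = gammaV |o| d a_i 0 0 = gammaA d a_i ∕ 2`) — the seven clauses of g35-d's `_each` are INHABITED at an actual
  `DrivenRuns` of record and an actual chart point; what stays displayed is exactly the free data (`a_i > 0`, contour systems with their
  length letters, weights `s_i`, depth `r`, levels, tags, bonds); and the W-17c twin **`hslice_covAtTLev_pair₂_decay_recordOne`** =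
  p230297 `hslice_covAtTLev_pair₂_decay_sectionOfRecord` at the same data with, in addition, the torus-size letters `h2A h2B`
  discharged by §0 (rates `kappaF |o| d a_i (gammaV |o| d a_i 0 0)`).
HONEST: a NON-VACUITY ∕ identification record at the trivial driving field only; at a non-trivial `V` the letters `α, τ` are Bałaban's
one-step regularity estimates (never substrate); nothing here bounds anything of NE5's.
HONEST DEPENDENCY (cell line, verbatim): continuum YM on T⁴ ⇐ BetaPertH ∧ nine spine estimates (0/9 proved); BetaPertH ⇐ (D1) ∧ (D4) ∧
CAP+tail; G-an2-4 gates asym, D1 and NE2/3/4.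
-/

noncomputable section

open scoped BigOperators ComplexConjugate Matrix Matrix.Norms.L2Operator Kronecker ComplexOrder
open Complex (I)

namespace Summit.QuantumFields.BalabanUV.T4Continuum.SubstrateSectionOfRecordOne

open Literature.MathematicalPhysics.QuantumFieldTheory.Balaban1983to89
open Literature.MathematicalPhysics.QuantumFieldTheory.Balaban1983to89.T4Continuum (T4Family)
open Literature.MathematicalPhysics.QuantumFieldTheory.Balaban1983to89.B5Prop11Plancherel (Tor fine)
open Literature.MathematicalPhysics.QuantumFieldTheory.Balaban1983to89.B5G183RateUnitTower (lev lev_neZero)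
open Literature.MathematicalPhysics.QuantumFieldTheory.Balaban1983to89.Beta.DeltaACombesThomas (gammaA gammaA_pos)
open Literature.MathematicalPhysics.QuantumFieldTheory.Balaban1983to89.Beta.TorusG0Decay (ldist)
open Literature.MathematicalPhysics.QuantumLattice (fundamentalRep fundamentalRep_mem_unitaryGroup)
open Summit.QuantumFields.BalabanUV.T4Continuum
open Summit.QuantumFields.BalabanUV.T4Continuum.CovariantVectorCoercive (vecOp gammaV)
open Summit.QuantumFields.BalabanUV.T4Continuum.CovariantBlockAveraging (ContourSystem transport transport_one)
open Summit.QuantumFields.BalabanUV.T4Continuum.CovariantVectorGreenDecayChartExplicit (kappaF)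
open Summit.QuantumFields.BalabanUV.T4Continuum.SubstrateBackgroundTransporters (unitMod transV_one)
open Summit.QuantumFields.BalabanUV.T4Continuum.SubstrateBackgroundDriven (iter_one)
open Summit.QuantumFields.BalabanUV.T4Continuum.SubstrateBlockAvgContinuity (drivenRecordSU blockAvg_expMeanLogSU_one)
open Summit.QuantumFields.BalabanUV.T4Continuum.SubstrateTransporterSpecies
open Summit.QuantumFields.BalabanUV.T4Continuum.SubstrateTransporterSpeciesLev (cPr aPr covAtTLev)
open Summit.QuantumFields.BalabanUV.T4Continuum.SubstrateChartSection (chi sectionOfRecord TwoRunChart)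
open Summit.QuantumFields.BalabanUV.T4Continuum.SubstrateChartRealSlice (unitaryLev₂)
open Summit.QuantumFields.BalabanUV.T4Continuum.SubstrateChartRealSlicePairSpecies (hslice_greenT_pair₂_sectionOfRecord
  hslice_covAtTLev_pair₂_sectionOfRecord)
open Summit.QuantumFields.BalabanUV.T4Continuum.SubstrateChartRealSlicePairSpeciesDecay (hslice_covAtTLev_pair₂_decay_sectionOfRecord)
open Summit.QuantumFields.BalabanUV.T4Continuum.SubstrateCovarianceChartBound (covBound)
open Summit.QuantumFields.BalabanUV.T4Continuum.SubstrateTwoRunsDriven (DrivenRuns)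

/-! ## §0 The torus-size letter is automatic -/

/-- [folklore] **`2 ≤ fine (lev P.L k) (unitMod P) μ` FOR EVERY `Params` AND LEVEL**: the unit lattice has `2·L^m ≥ 2` sites per direction and
`lev P.L k = L^k ≥ 1` — the displayed torus-size letter `h2` of `CovariantVectorCovarianceDecayChart∕…Blocks` (L-A9∕L-A9b) is a theorem. -/
theorem two_le_fine_lev_unitMod (P : Params) (k : ℕ) (μ : Fin P.d) : 2 ≤ fine (lev P.L k) (unitMod P) μ := by
  show 2 ≤ lev P.L k * (2 * P.L ^ P.m)
  haveI : NeZero P.L := ⟨by have := P.hL.2; omega⟩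
  have h1 : 1 ≤ lev P.L k := Nat.pos_of_ne_zero (NeZero.ne _)
  have h2 : 1 ≤ P.L ^ P.m := Nat.one_le_pow _ _ (by have := P.hL.2; omega)
  nlinarith

/-! ## §1 The trivial configuration: tower data and regular-background letters with `α = τ = 0` -/

section Generic

variable (P : Params) {G : Type*} [GaugeGroup G] {o : Type*} [Fintype o] [DecidableEq o] (ι : G →* Matrix o o ℂ)
  (av : ∀ j, Averaging P j G) (hav1 : ∀ j, (av j).avg 1 = 1)

include hav1 in
/-- [folklore] **THE TOWER DATA OF THE TRIVIAL CONFIGURATION IS THE TRIVIAL TRANSPORTER TOWER** (averagings fixing `1`: `iter_one`; `transV_one`). -/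
theorem towerDataOf_one : towerDataOf P ι av (1 : GaugeField P 0 G) = fun _ _ _ => 1 := by
  funext k ν i
  simp only [towerDataOf, iter_one av hav1, transV_one]

include hav1 in
/-- [folklore] **THE LETTER `hU` WITH `α = 0` AT `U = 1`**: `n_k · dist1 ((M^{K−k} 1)(b)) ≤ 0` at every level and bond. -/
theorem regU_one (k : Fin (P.K + 1)) (b : PBond P (P.K - k)) :
    ((lev P.L k : ℕ) : ℝ) * dist1 (Averaging.iter av (P.K - k) (1 : GaugeField P 0 G) b) ≤ 0 := by
  rw [iter_one av hav1]
  show ((lev P.L k : ℕ) : ℝ) * dist1 (1 : G) ≤ 0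
  rw [GaugeGroup.dist1_one, mul_zero]

include hav1 in
/-- [folklore] **THE LETTER `hT` WITH `τ = 0` AT `U = 1`**: every contour transport of the trivial tower is `1`. -/
theorem regT_towerDataOf_one (k : Fin (P.K + 1)) (μ : Fin P.d) (Γ : List (Tor (fine (lev P.L k) (unitMod P)) × Fin P.d)) :
    ‖transport (fine (lev P.L k) (unitMod P)) (towerDataOf P ι av (1 : GaugeField P 0 G) k) μ Γ - 1‖ ≤ 0 := by
  rw [towerDataOf_one P ι av hav1]
  show ‖transport (fine (lev P.L k) (unitMod P)) (fun _ _ => (1 : Matrix o o ℂ)) μ Γ - 1‖ ≤ 0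
  rw [transport_one, sub_self, norm_zero]

end Generic

/-- [folklore] **`gammaV co d a′ 0 0 = gammaA d a′ ∕ 2`** — at `α = τ = 0` the coercivity letter of `CovariantVectorCoercive` is half the free one. -/
theorem gammaV_zero_zero (co d : ℕ) (a' : ℝ) : gammaV co d a' 0 0 = gammaA d a' / 2 := by
  simp [gammaV]

/-- [folklore] **`0 < gammaV co d a′ 0 0`** (`gammaA_pos`). -/
theorem gammaV_zero_zero_pos (co d : ℕ) (a' : ℝ) : 0 < gammaV co d a' 0 0 := by
  rw [gammaV_zero_zero]; exact half_pos (gammaA_pos a')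

/-! ## §2 The `SU(n)` reading of record: `ι := fundamentalRep`, `hdist` is definitional -/

section SU

variable {o : Type} [Fintype o] [DecidableEq o] [Nonempty o]

/-- [folklore] **`hdist` DISCHARGED ON `SU(n)`**: `‖fundamentalRep o g − 1‖ = dist1 g` — the tree's `GaugeGroup` structure on `SU(n)` IS the one
induced by the fundamental representation (`instGaugeGroupSpecialUnitaryGroup = GaugeGroup.ofUnitaryRep _ (fundamentalRep o) _`, `dist1 := opDist1 ∘ ρ`). -/
theorem norm_fundamentalRep_sub_one (g : Matrix.specialUnitaryGroup o ℂ) : ‖fundamentalRep o g - 1‖ = dist1 g := rfl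

/-! ## §3 At the record `drivenRecordSU F K m′ gA gB`, trivial driving field -/

variable (F : T4Family) (K m' : ℕ) (gA gB : ℕ → ℝ)

/-- [folklore] Run A's averagings of the record are Bałaban's block averaging at `expMeanLogSU` (`rfl`). -/
theorem drivenRecordSU_avA (j : ℕ) :
    (drivenRecordSU (n := o) F K m' gA gB).avA j = BlockAveraging.blockAvg ExpMeanLog.expMeanLogSU := rfl

/-- [folklore] Run B's averagings of the record (`rfl`). -/
theorem drivenRecordSU_avB (j : ℕ) :
    (drivenRecordSU (n := o) F K m' gA gB).avB j = BlockAveraging.blockAvg ExpMeanLog.expMeanLogSU := rfl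

/-- [folklore] The record's transport averaging (`rfl`). -/
theorem drivenRecordSU_av : (drivenRecordSU (n := o) F K m' gA gB).av = BlockAveraging.blockAvg ExpMeanLog.expMeanLogSU := rfl

/-- [folklore] Every run-A ∕ run-B averaging of the record fixes the trivial configuration (`blockAvg_expMeanLogSU_one`). -/
theorem drivenRecordSU_avA_one (j : ℕ) : ((drivenRecordSU (n := o) F K m' gA gB).avA j).avg 1 = 1 :=
  blockAvg_expMeanLogSU_one _ _

/-- [folklore] run B twin. -/
theorem drivenRecordSU_avB_one (j : ℕ) : ((drivenRecordSU (n := o) F K m' gA gB).avB j).avg 1 = 1 :=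
  blockAvg_expMeanLogSU_one _ _

variable {F K m' gA gB}

/-- [folklore] **THE TRANSPORTED TRIVIAL BACKGROUND IS TRIVIAL**: for `U.1 = 1`, `(C.transport U).1 = 1` (one block averaging fixing `1`, then the
level identification). -/
theorem transport_val_eq_one {U : (drivenRecordSU (n := o) F K m' gA gB).carriers.BgB} (hU : U.1 = 1) :
    ((drivenRecordSU (n := o) F K m' gA gB).carriers.transport U).1 = 1 := by
  funext b
  rw [B13Carriers.TwoRuns.carriers_transport_apply, hU, ← (drivenRecordSU (n := o) F K m' gA gB).avB_zero, drivenRecordSU_avB_one]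
  rfl

variable (ι : Matrix.specialUnitaryGroup o ℂ →* Matrix o o ℂ)

/-- [folklore] **THE SECTION POINT OF THE TRIVIAL BACKGROUND IS THE PAIR OF TRIVIAL TOWERS** (any reading `ι`). -/
theorem sectionOfRecord_eq_one {U : (drivenRecordSU (n := o) F K m' gA gB).carriers.BgB} (hU : U.1 = 1) :
    sectionOfRecord (drivenRecordSU (n := o) F K m' gA gB) ι U = (fun _ _ _ => 1, fun _ _ _ => 1) := by
  rw [sectionOfRecord, transport_val_eq_one hU, hU, towerDataOf_one _ ι _ (drivenRecordSU_avA_one F K m' gA gB),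
    towerDataOf_one _ ι _ (drivenRecordSU_avB_one F K m' gA gB)]

/-! ### §3b The W-17b pair packages at the reference point, every small-field letter discharged -/

variable (ΓA : (k : ℕ) → ContourSystem (F.P K).d (lev (F.P K).L k) (unitMod (F.P K)))
  (ΓB : (k : ℕ) → ContourSystem (F.P (K + 1)).d (lev (F.P (K + 1)).L k) (unitMod (F.P (K + 1))))
  {aA aB : ℝ} (haA : 0 < aA) (haB : 0 < aB)
  {ℓA : Fin ((F.P K).K + 1) → ℕ} {ℓB : Fin ((F.P (K + 1)).K + 1) → ℕ}
  (hΓA : ∀ (k : Fin ((F.P K).K + 1)) y j μ (t : Fin (lev (F.P K).L k)), (ΓA k y j μ t).length ≤ ℓA k)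
  (hΓB : ∀ (k : Fin ((F.P (K + 1)).K + 1)) y j μ (t : Fin (lev (F.P (K + 1)).L k)), (ΓB k y j μ t).length ≤ ℓB k)
  (hℓA : ∀ k : Fin ((F.P K).K + 1), (ℓA k : ℝ) ≤ (((F.P K).d : ℝ) + 1) * (lev (F.P K).L k : ℕ))
  (hℓB : ∀ k : Fin ((F.P (K + 1)).K + 1), (ℓB k : ℝ) ≤ (((F.P (K + 1)).d : ℝ) + 1) * (lev (F.P (K + 1)).L k : ℕ))
  {U : (drivenRecordSU (n := o) F K m' gA gB).carriers.BgB} (hU : U.1 = 1)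

include haA haB hΓA hΓB hℓA hℓB hU in
/-- [folklore] **THE TWO RUNS' GREEN OPERATORS ALONG ONE DISC THROUGH THE REFERENCE POINT OF RECORD — INHABITED**: p229325
`hslice_greenT_pair₂_sectionOfRecord` at `D := drivenRecordSU F K m′ gA gB`, `ι := fundamentalRep o`, a background `U` with `U.1 = 1`, with
`hι` (`fundamentalRep_mem_unitaryGroup`), `hdist` (§2), `hUA hTA hUB hTB` (§1∕§3, `α = τ = 0`) and `0 < gammaV … a 0 0` (§1) ALL DISCHARGED. -/
theorem hslice_greenT_pair₂_recordOne {r : ℝ} (hr : 0 < r) (kA : Fin ((F.P K).K + 1)) (kB : Fin ((F.P (K + 1)).K + 1)) :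
    ∃ γ : ℂ → TwoRunChart (drivenRecordSU (n := o) F K m' gA gB) o, ∃ z₀ : ℂ, ‖z₀‖ ≤ r ∧
      γ z₀ = sectionOfRecord (drivenRecordSU (n := o) F K m' gA gB) (fundamentalRep o) U ∧
      (∀ x : ℝ, |x| < 1 → γ x ∈ unitaryLev₂ (drivenRecordSU (n := o) F K m' gA gB)) ∧
      DiffContOnCl ℂ (fun z => greenT (lev (F.P K).L kA) (unitMod (F.P K)) (cPr (F.P K) kA) (aPr (F.P K) aA kA) (ΓA kA)
        ((chi _ (γ z).1).1 kA) ((chi _ (γ z).1).2 kA)) (Metric.ball (0 : ℂ) 1) ∧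
      DiffContOnCl ℂ (fun z => greenT (lev (F.P (K + 1)).L kB) (unitMod (F.P (K + 1))) (cPr (F.P (K + 1)) kB) (aPr (F.P (K + 1)) aB kB)
        (ΓB kB) ((chi _ (γ z).2).1 kB) ((chi _ (γ z).2).2 kB)) (Metric.ball (0 : ℂ) 1) ∧
      (∀ z : ℂ, ‖z‖ ≤ 1 → ‖greenT (lev (F.P K).L kA) (unitMod (F.P K)) (cPr (F.P K) kA) (aPr (F.P K) aA kA) (ΓA kA)
        ((chi _ (γ z).1).1 kA) ((chi _ (γ z).1).2 kA)‖ ≤ 4 / gammaV (Fintype.card o) (F.P K).d aA 0 0) ∧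
      ∀ z : ℂ, ‖z‖ ≤ 1 → ‖greenT (lev (F.P (K + 1)).L kB) (unitMod (F.P (K + 1))) (cPr (F.P (K + 1)) kB) (aPr (F.P (K + 1)) aB kB)
        (ΓB kB) ((chi _ (γ z).2).1 kB) ((chi _ (γ z).2).2 kB)‖ ≤ 4 / gammaV (Fintype.card o) (F.P (K + 1)).d aB 0 0 :=
  hslice_greenT_pair₂_sectionOfRecord (drivenRecordSU (n := o) F K m' gA gB) ΓA ΓB (fundamentalRep o) fundamentalRep_mem_unitaryGroup
    (fun _ => rfl) U haA le_rfl le_rfl haB le_rfl le_rfl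
    (fun k b => by rw [transport_val_eq_one hU]; exact regU_one _ _ (drivenRecordSU_avA_one F K m' gA gB) k b)
    (fun k y jj μ t => by
      rw [SubstrateChartSection.sectionOfRecord_fst, transport_val_eq_one hU]
      exact regT_towerDataOf_one _ (fundamentalRep o) _ (drivenRecordSU_avA_one F K m' gA gB) k μ _)
    (fun k b => by rw [hU]; exact regU_one _ _ (drivenRecordSU_avB_one F K m' gA gB) k b)
    (fun k y jj μ t => by
      rw [SubstrateChartSection.sectionOfRecord_snd, hU]
      exact regT_towerDataOf_one _ (fundamentalRep o) _ (drivenRecordSU_avB_one F K m' gA gB) k μ _)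
    (gammaV_zero_zero_pos _ _ _) (gammaV_zero_zero_pos _ _ _) hΓA hΓB hℓA hℓB hr kA kB

include haA haB hΓA hΓB hℓA hℓB hU in
/-- [folklore] **THE TWO RUNS' COVARIANCE ENTRIES ALONG ONE DISC THROUGH THE REFERENCE POINT OF RECORD — INHABITED**: p229325
`hslice_covAtTLev_pair₂_sectionOfRecord` at the same data, every small-field letter discharged; closed-disc bounds W-15's
`covBound (F.P K) o (gammaV |o| d aA 0 0) sA kA` ∕ `covBound (F.P (K+1)) o (gammaV |o| d aB 0 0) sB kB`. -/
theorem hslice_covAtTLev_pair₂_recordOne (sA sB : ℕ → ℂ) {r : ℝ} (hr : 0 < r) (kA kB : ℕ) {TA TB : Type*} (tA : TA) (tB : TB)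
    (bA bA' : (Tor (unitMod (F.P K)) × Fin (F.P K).d) × o) (bB bB' : (Tor (unitMod (F.P (K + 1))) × Fin (F.P (K + 1)).d) × o) :
    ∃ γ : ℂ → TwoRunChart (drivenRecordSU (n := o) F K m' gA gB) o, ∃ z₀ : ℂ, ‖z₀‖ ≤ r ∧
      γ z₀ = sectionOfRecord (drivenRecordSU (n := o) F K m' gA gB) (fundamentalRep o) U ∧
      (∀ x : ℝ, |x| < 1 → γ x ∈ unitaryLev₂ (drivenRecordSU (n := o) F K m' gA gB)) ∧
      DiffContOnCl ℂ (fun z => covAtTLev (F.P K) (cPr (F.P K)) (aPr (F.P K) aA) ΓA sA (chi _ (γ z).1).1 (chi _ (γ z).1).2 kA tA bA bA')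
        (Metric.ball (0 : ℂ) 1) ∧
      DiffContOnCl ℂ (fun z => covAtTLev (F.P (K + 1)) (cPr (F.P (K + 1))) (aPr (F.P (K + 1)) aB) ΓB sB (chi _ (γ z).2).1 (chi _ (γ z).2).2
        kB tB bB bB') (Metric.ball (0 : ℂ) 1) ∧
      (∀ z : ℂ, ‖z‖ ≤ 1 → ‖covAtTLev (F.P K) (cPr (F.P K)) (aPr (F.P K) aA) ΓA sA (chi _ (γ z).1).1 (chi _ (γ z).1).2 kA tA bA bA'‖
        ≤ covBound (F.P K) o (gammaV (Fintype.card o) (F.P K).d aA 0 0) sA kA) ∧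
      ∀ z : ℂ, ‖z‖ ≤ 1 → ‖covAtTLev (F.P (K + 1)) (cPr (F.P (K + 1))) (aPr (F.P (K + 1)) aB) ΓB sB (chi _ (γ z).2).1 (chi _ (γ z).2).2
        kB tB bB bB'‖ ≤ covBound (F.P (K + 1)) o (gammaV (Fintype.card o) (F.P (K + 1)).d aB 0 0) sB kB :=
  hslice_covAtTLev_pair₂_sectionOfRecord (drivenRecordSU (n := o) F K m' gA gB) ΓA ΓB (fundamentalRep o) fundamentalRep_mem_unitaryGroup
    (fun _ => rfl) U haA le_rfl le_rfl haB le_rfl le_rfl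
    (fun k b => by rw [transport_val_eq_one hU]; exact regU_one _ _ (drivenRecordSU_avA_one F K m' gA gB) k b)
    (fun k y jj μ t => by
      rw [SubstrateChartSection.sectionOfRecord_fst, transport_val_eq_one hU]
      exact regT_towerDataOf_one _ (fundamentalRep o) _ (drivenRecordSU_avA_one F K m' gA gB) k μ _)
    (fun k b => by rw [hU]; exact regU_one _ _ (drivenRecordSU_avB_one F K m' gA gB) k b)
    (fun k y jj μ t => by
      rw [SubstrateChartSection.sectionOfRecord_snd, hU]
      exact regT_towerDataOf_one _ (fundamentalRep o) _ (drivenRecordSU_avB_one F K m' gA gB) k μ _)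
    (gammaV_zero_zero_pos _ _ _) (gammaV_zero_zero_pos _ _ _) hΓA hΓB hℓA hℓB sA sB hr kA kB tA tB bA bA' bB bB'

/-! ### §3c The W-17c decay-weighted package at the reference point (torus-size letters discharged too) -/

include haA haB hΓA hΓB hℓA hℓB hU in
/-- [folklore] **W-17c's DECAY-WEIGHTED COVARIANCE PACKAGE AT THE REFERENCE POINT OF RECORD — INHABITED**: p1's
`hslice_covAtTLev_pair₂_decay_sectionOfRecord` at `D := drivenRecordSU F K m′ gA gB`, `ι := fundamentalRep o`, `U.1 = 1`, with
`hι hdist hα hτ hUA hTA hUB hTB hγVA hγVB` AND the torus-size letters `h2A h2B` (§0) ALL DISCHARGED; rates `kappaF |o| d a_i (gammaV |o| d a_i 0 0)`. -/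
theorem hslice_covAtTLev_pair₂_decay_recordOne (sA sB : ℕ → ℂ) {r : ℝ} (hr : 0 < r) (kA kB : ℕ) {TA TB : Type*} (tA : TA) (tB : TB)
    (bA bA' : (Tor (unitMod (F.P K)) × Fin (F.P K).d) × o) (bB bB' : (Tor (unitMod (F.P (K + 1))) × Fin (F.P (K + 1)).d) × o) :
    ∃ γ : ℂ → TwoRunChart (drivenRecordSU (n := o) F K m' gA gB) o, ∃ z₀ : ℂ, ‖z₀‖ ≤ r ∧
      γ z₀ = sectionOfRecord (drivenRecordSU (n := o) F K m' gA gB) (fundamentalRep o) U ∧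
      (∀ x : ℝ, |x| < 1 → γ x ∈ unitaryLev₂ (drivenRecordSU (n := o) F K m' gA gB)) ∧
      DiffContOnCl ℂ (fun z => covAtTLev (F.P K) (cPr (F.P K)) (aPr (F.P K) aA) ΓA sA (chi _ (γ z).1).1 (chi _ (γ z).1).2 kA tA bA bA')
        (Metric.ball (0 : ℂ) 1) ∧
      DiffContOnCl ℂ (fun z => covAtTLev (F.P (K + 1)) (cPr (F.P (K + 1))) (aPr (F.P (K + 1)) aB) ΓB sB (chi _ (γ z).2).1 (chi _ (γ z).2).2
        kB tB bB bB') (Metric.ball (0 : ℂ) 1) ∧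
      (∀ z : ℂ, ‖z‖ ≤ 1 → ‖covAtTLev (F.P K) (cPr (F.P K)) (aPr (F.P K) aA) ΓA sA (chi _ (γ z).1).1 (chi _ (γ z).1).2 kA tA bA bA'‖
        ≤ (‖sA kA‖ * (16 * Fintype.card o * (((lev (F.P K).L kA : ℕ) : ℝ) ^ (F.P K).d)⁻¹) * (8 / gammaV (Fintype.card o) (F.P K).d aA 0 0) *
            Real.exp (2 * kappaF (Fintype.card o) (F.P K).d aA (gammaV (Fintype.card o) (F.P K).d aA 0 0))) *
          Real.exp (-(kappaF (Fintype.card o) (F.P K).d aA (gammaV (Fintype.card o) (F.P K).d aA 0 0) *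
            ldist (unitMod (F.P K)) bA.1.1 bA'.1.1))) ∧
      ∀ z : ℂ, ‖z‖ ≤ 1 → ‖covAtTLev (F.P (K + 1)) (cPr (F.P (K + 1))) (aPr (F.P (K + 1)) aB) ΓB sB (chi _ (γ z).2).1 (chi _ (γ z).2).2
        kB tB bB bB'‖
        ≤ (‖sB kB‖ * (16 * Fintype.card o * (((lev (F.P (K + 1)).L kB : ℕ) : ℝ) ^ (F.P (K + 1)).d)⁻¹) *
              (8 / gammaV (Fintype.card o) (F.P (K + 1)).d aB 0 0) *
            Real.exp (2 * kappaF (Fintype.card o) (F.P (K + 1)).d aB (gammaV (Fintype.card o) (F.P (K + 1)).d aB 0 0))) *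
          Real.exp (-(kappaF (Fintype.card o) (F.P (K + 1)).d aB (gammaV (Fintype.card o) (F.P (K + 1)).d aB 0 0) *
            ldist (unitMod (F.P (K + 1))) bB.1.1 bB'.1.1)) :=
  hslice_covAtTLev_pair₂_decay_sectionOfRecord (drivenRecordSU (n := o) F K m' gA gB) ΓA ΓB (fundamentalRep o) fundamentalRep_mem_unitaryGroup
    (fun _ => rfl) U haA le_rfl le_rfl haB le_rfl le_rfl
    (fun k b => by rw [transport_val_eq_one hU]; exact regU_one _ _ (drivenRecordSU_avA_one F K m' gA gB) k b)
    (fun k y jj μ t => by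
      rw [SubstrateChartSection.sectionOfRecord_fst, transport_val_eq_one hU]
      exact regT_towerDataOf_one _ (fundamentalRep o) _ (drivenRecordSU_avA_one F K m' gA gB) k μ _)
    (fun k b => by rw [hU]; exact regU_one _ _ (drivenRecordSU_avB_one F K m' gA gB) k b)
    (fun k y jj μ t => by
      rw [SubstrateChartSection.sectionOfRecord_snd, hU]
      exact regT_towerDataOf_one _ (fundamentalRep o) _ (drivenRecordSU_avB_one F K m' gA gB) k μ _)
    (gammaV_zero_zero_pos _ _ _) (gammaV_zero_zero_pos _ _ _) hΓA hΓB hℓA hℓB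
    (fun k μ => two_le_fine_lev_unitMod _ k μ) (fun k μ => two_le_fine_lev_unitMod _ k μ) sA sB hr kA kB tA tB bA bA' bB bB'

end SU

end Summit.QuantumFields.BalabanUV.T4Continuum.SubstrateSectionOfRecordOne

end
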